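import Literature.NumberTheory.LFunctions.Zhang2022.RepairIntakeWitnesses
import Literature.NumberTheory.LFunctions.Zhang2022.RepairBlenMuNu
import Literature.NumberTheory.LFunctions.Zhang2022.KnifeEdgeEndgameClosed
import HarnessLib

/-!
# Kernel satisfiability witnesses (W1), second file: NON-DEGENERATE inhabitants of two residual slot heads —
# the first-order slots `BAH`/`HExp`/`HExpII` (model-exact world on the derived `K₀` data) and `HasMainConstant`
# for the UNIT table (derived from the closed units lemma)

Topic `Literature/NumberTheory/LFunctions/Zhang2022` (Landau–Siegel audit tree; verdict-neutral), cell landau-siegel,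
D-0124 rescue, typer seat ls-rescue-typ-1 (g3). Companion of `RepairIntakeWitnesses` (p537156/p538237, typ-1 g2) and
`RepairDesignWitnesses` (p537668/p538133, typ-2 g2) and `RepairLambdaWitnesses` (p540872, typ-2 g3: the Λ-block
Cauchy–Schwarz slots and the jump-kernel sign — NOT repeated here, ruling ls-rescue-lead 2026-08-27 14:52:27Z; rev 2 of
this file removed its duplicate §§ on those heads). W1 rule of record (director-frontier 2026-08-27 11:36:58Z, census
ls-rescue-ref-1 SAT-CENSUS v2.1b): a certificate `H₁ ∧ … ∧ Hₙ → C` is WITNESSED(a) when every open hypothesis HEAD has a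
NON-DEGENERATE in-tree inhabitant (zero models / zero profiles / `Z = ∅` are «shape» only). Census v2.1b left
UNWITNESSED 100 = 13 doors + 68 open-head + 11 SHAPE + 8 FRAME; this file addresses two heads a kernel object CAN
inhabit honestly, and APPLIES each consumer theorem at the inhabitant (the typ-2 pattern), so that the flip is visible:

* **§1 `Repair.BAH` / `HExp` / `HExpII` — the MODEL-EXACT world on DERIVED data** (replaces the ZERO models
  `SatWitness.bah_zero/hexp_zero/hexpII_zero` of the first file for the 11 SHAPE rows). The exact form is taken to BE
  the derived first-order model plus a unit second-order remainder, `Q_A(p) := value(p)/A + A⁻²` (`modelExactForm`,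
  `≢ 0`), on the model-admissible box of record `𝓜 = k0Model 0 (−½) = [−½, 0] × [1/(2π), ∞)` with the DERIVED
  `K₀`-plane data of `RepairIntakeBell` (member of record `ι = (1, −1)` = `k₁ − k₃`, printed frame `τ₀ = 0`; second
  vector `ι = (0, 1)` = `k₂ + k₃` standing in for the reflected piece): `BAH` holds because the derived first-order
  value is `≥ 0` on `𝓜` (`Repair.familyBellK0Plane_decided`, i.e. `EllRegime.modelConsistentOn_k0Plane`, p472567)
  and `A⁻² > 0`; `HExp`/`HExpII` hold with remainder EXACTLY `A⁻²` (`K = 1`). Members `k0DirectMember : DirectDesign`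
  (class `KDirect` by `SatWitness.ellAdmissible_one_printed`) and `k0TwoSidedMember : TwoSidedDesign`; consumers applied:
  `HExp.mono`, `expansion_of_slots`, `firstOrderExpansion_of_{slots,direct,twoSided}`, `modelConsistentOn_of_slots`,
  `vbell_firstOrder_of_{direct,twoSided}`, `hexp_add`, `hexpII_of_pieces`, `hexp_total_of_twoSided`.
  HONEST LABEL: this is a consistent (A)-WORLD MODEL in which dict-1 is exact to second order; it says NOTHING about
  Zhang's own form `Q_A(d; p)` — the CONTENT of the slots (registry E-014 B-AH, E-022 formula I, D-ELL-1c-II) stays OPEN.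
* **§2 `Repair.HasMainConstant` — a REAL (A)-world row, DERIVED**: for every sufficiently large `c′` the UNIT table
  `F ≡ 1` (the Dirichlet polynomial `1`) has main constant `8/π` at the scale `𝓛⁹`:
  `|discMean(1) − (8/π)𝓛⁹𝔓| ≤ ε𝓛⁹𝔓` eventually under (A) — from the fully closed units lemma
  `KnifeEdge.discWeight_trivialScale_closed'` (Prop 7.1 `prop71X_holds`, Lemma 8.1 / Prop 2.2 (i) / Lemma 2.3 by
  `Skeleton.partOne_eventually`) and the weight identification `discMean(1) = discWeight` under Lemma 2.3 / Prop 2.2 (i)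
  (`KnifeEdge.weights_nonneg_of`). Also `scaleEventuallyPos_ellNine`. The `∃ c₀` binder is the manuscript's «for some
  (large) constant `c′ > 0`».

NOT here: the λ-CS slots and `JumpKernelPos` (witnessed in `RepairLambdaWitnesses`, typ-2 g3). NOT attempted (correctly
UNWITNESSED — open (A)-world analytic rows or real interval numerics): `BandMeanValue{,On,Lip}`, `DiscMean*`,
`Bulk/Band/CrossAsympAt`, `ECrossBandAsymp`, `Eq148*`, `EllLambdaPinned`, `Ineq232With`, the cover FRAME, the 13 author
doors. Nothing here is a claim about the manuscript, about (A), or about any verdict. «The programme SEARCHES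
and TYPES; no claim about Landau–Siegel zeros, Theorems 1–2 of arXiv:2211.02515 or a repaired Margin232 until a kernel
theorem says so.»

## References

* [Zhang2022LandauSiegel] Y. Zhang, arXiv:2211.02515v1, §2 (2.13), (2.15)–(2.16), (2.31)–(2.32), Lemma 2.3,
  Prop. 2.2 (i); §7 Prop. 7.1 (7.2); §8 (8.3), Lemma 8.1, (8.23); §9 (9.1); §12 (12.8).
* Tree: `RepairIntakeBell` / `RepairIntakeBellMembers` (slots, members, `k0Model`, `k0G₀/₁/₂`), `EllRegimeK0Plane`
  (p472567), `RepairIntakeWitnesses` (`ellAdmissible_one_printed`), `RepairBlenMuNu` (`HasMainConstant`, `Scale`),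
  `KnifeEdgeEStarLen` (`discMean`, `weights_nonneg_of`), `RepairRplus` (`discWeight`), `KnifeEdgeEndgameClosed` Part 8,
  `Section4Prop22Eventually` (`partOne_eventually`).
-/

noncomputable section

open Real Set
open scoped ComplexConjugate

namespace Literature.NumberTheory.LFunctions.Zhang2022.Repair.SatWitness

open Literature.NumberTheory.LFunctions.Zhang2022
open Literature.NumberTheory.LFunctions.Zhang2022.Repair
open Literature.NumberTheory.LFunctions.Zhang2022.EllRegime
open Literature.NumberTheory.LFunctions.Zhang2022.KnifeEdge
open Literature.NumberTheory.LFunctions.Zhang2022.Skeleton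

/-! ### §1 — `BAH` / `HExp` / `HExpII`: the model-exact world on the derived `K₀` data -/

/-- **The model-exact form**: the (A)-world's exact form is TAKEN TO BE the first-order model plus a unit second-order
remainder, `Q_A(p) := value(p)/A + A⁻²` (`value = firstOrderValue data p`). A MODEL of the slot shapes, `≢ 0`; not
Zhang's `Q_A(d;p)`. [cite: Zhang2022LandauSiegel, §2 (2.13), (2.32); §8 (8.23)] -/
def modelExactForm (data : ℝ × ℝ × ℝ × ℝ) : ℝ × ℝ → ℝ → ℝ :=
  fun p A => firstOrderValue data.1 data.2.1 data.2.2.1 data.2.2.2 p / A + 1 / A ^ 2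

/-- Unfolding lemma. [cite: Zhang2022LandauSiegel, §2 (2.32)] -/
theorem modelExactForm_apply (data : ℝ × ℝ × ℝ × ℝ) (p : ℝ × ℝ) (A : ℝ) :
    modelExactForm data p A = firstOrderValue data.1 data.2.1 data.2.2.1 data.2.2.2 p / A + 1 / A ^ 2 := rfl

/-- **`BAH` in the model-exact world**: if the first-order value is `≥ 0` on `𝓜` (model consistency), the model-exact
form is `≥ 0` on `𝓜` for `A ≥ 1`. [cite: Zhang2022LandauSiegel, §2 Lemma 2.3, (2.15), (2.32)] -/
theorem bah_modelExactForm {𝓜 : Set (ℝ × ℝ)} {data : ℝ × ℝ × ℝ × ℝ}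
    (h : ModelConsistentOn 𝓜 data.1 data.2.1 data.2.2.1 data.2.2.2) : BAH 𝓜 (modelExactForm data) 1 := by
  intro p hp A hA
  have hA0 : 0 < A := lt_of_lt_of_le one_pos hA
  have hv := h p hp
  rw [modelExactForm_apply]
  positivity

/-- **`HExp` in the model-exact world**, with remainder EXACTLY `A⁻²` (`K = 1`), from any threshold.
[cite: Zhang2022LandauSiegel, §2 (2.32); §8 (8.23)] -/
theorem hexp_modelExactForm (𝓜 : Set (ℝ × ℝ)) (data : ℝ × ℝ × ℝ × ℝ) (A₀ : ℝ) :
    HExp 𝓜 (modelExactForm data) data A₀ 1 := by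
  intro p _ A _
  rw [modelExactForm_apply, add_sub_cancel_left, abs_of_nonneg (by positivity)]

/-- The remainder is ATTAINED: at every datum and every `A ≠ 0` the model-exact form differs from `value/A` by exactly
`A⁻² ≠ 0` — the inhabitant is not the remainder-free one. [cite: Zhang2022LandauSiegel, §2 (2.32)] -/
theorem modelExactForm_sub_firstOrder (data : ℝ × ℝ × ℝ × ℝ) (p : ℝ × ℝ) {A : ℝ} (hA : A ≠ 0) :
    modelExactForm data p A - firstOrderValue data.1 data.2.1 data.2.2.1 data.2.2.2 p / A = 1 / A ^ 2 ∧
      (1 / A ^ 2 : ℝ) ≠ 0 :=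
  ⟨by rw [modelExactForm_apply, add_sub_cancel_left], by positivity⟩

/-- The DERIVED first-order data of the `K₀`-plane member of record `ι = (1, −1)` (`k₁ − k₃`), printed frame `τ₀ = 0`
(`RepairIntakeBell.k0G₀/k0G₁/k0G₂`; gain `0`). [cite: Zhang2022LandauSiegel, §2 (2.13), (2.32)] -/
def k0Data13 : ℝ × ℝ × ℝ × ℝ := (0, k0G₀ 1 (-1) 0, k0G₁ 1 (-1), k0G₂ 1 (-1))

/-- The derived first-order data of the `K₀`-plane vector `ι = (0, 1)` (`k₂ + k₃`), printed frame — used below as the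
data of the second (reflected-slot) piece of the two-sided model member. [cite: Zhang2022LandauSiegel, §2 (2.13), (2.32)] -/
def k0Data23 : ℝ × ℝ × ℝ × ℝ := (0, k0G₀ 0 1 0, k0G₁ 0 1, k0G₂ 0 1)

/-- The derived `k₁ − k₃` data are model-consistent on the box of record `k0Model 0 (−½)`
(`Repair.familyBellK0Plane_decided`, p472567). [cite: Zhang2022LandauSiegel, §2 Lemma 2.3, (2.13), (2.32)] -/
theorem modelConsistentOn_k0Data13 :
    ModelConsistentOn (k0Model 0 (-(1 / 2))) k0Data13.1 k0Data13.2.1 k0Data13.2.2.1 k0Data13.2.2.2 :=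
  familyBellK0Plane_decided ⟨1, -1, 0, -(1 / 2)⟩ (show (0 : ℝ) ≤ 0 from le_rfl)

/-- The derived `k₂ + k₃` data are model-consistent on the same box. [cite: Zhang2022LandauSiegel, §2 Lemma 2.3, (2.13), (2.32)] -/
theorem modelConsistentOn_k0Data23 :
    ModelConsistentOn (k0Model 0 (-(1 / 2))) k0Data23.1 k0Data23.2.1 k0Data23.2.2.1 k0Data23.2.2.2 :=
  familyBellK0Plane_decided ⟨0, 1, 0, -(1 / 2)⟩ (show (0 : ℝ) ≤ 0 from le_rfl)

/-- **A named formula-I member with NON-DEGENERATE slots**: Zhang's printed exponents `(0.504, 0.5, 0.498, 0.5)` on the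
limit sheet, the derived `k₁ − k₃` data, the box of record, the model-exact form, `A₀ = K = 1`.
[cite: Zhang2022LandauSiegel, §2 (2.13), (2.21)–(2.26), (2.32)] -/
def k0DirectMember : DirectDesign where
  e := ⟨0.504, 0.5, 0.498, 0.5⟩
  σ := ⟨0, 0⟩
  data := k0Data13
  𝓜 := k0Model 0 (-(1 / 2))
  Q := modelExactForm k0Data13
  A₀ := 1
  K := 1

/-- The member is in the class `KDirect` (§2 admissibility at `x = 1`: `SatWitness.ellAdmissible_one_printed`).
[cite: Zhang2022LandauSiegel, §2 (2.21); §14 (14.2)] -/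
theorem kDirect_k0DirectMember : KDirect k0DirectMember := ellAdmissible_one_printed

/-- Slot hQ (`BAH`) holds for the member. [cite: Zhang2022LandauSiegel, §2 Lemma 2.3, (2.15), (2.32)] -/
theorem bah_k0Direct : BAH k0DirectMember.𝓜 k0DirectMember.Q k0DirectMember.A₀ :=
  bah_modelExactForm modelConsistentOn_k0Data13

/-- Slot hexp (`HExp`) holds for the member, remainder `K = 1`. [cite: Zhang2022LandauSiegel, §2 (2.32); §8 (8.23)] -/
theorem hexp_k0Direct : HExp k0DirectMember.𝓜 k0DirectMember.Q k0DirectMember.data k0DirectMember.A₀ k0DirectMember.K :=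
  hexp_modelExactForm _ _ _

/-- **Consumers applied (direct member)**: `firstOrderExpansion_of_direct`, `vbell_firstOrder_of_direct`,
`expansion_of_slots`, `firstOrderExpansion_of_slots`, `modelConsistentOn_of_slots` at the member's slots.
[cite: Zhang2022LandauSiegel, §2 Lemma 2.3, (2.32)] -/
theorem k0Direct_witness :
    FirstOrderExpansion k0DirectMember.𝓜 k0DirectMember.data ∧
      ModelConsistentOn k0DirectMember.𝓜 k0DirectMember.data.1 k0DirectMember.data.2.1 k0DirectMember.data.2.2.1
        k0DirectMember.data.2.2.2 ∧
      FirstOrderExpansion (k0Model 0 (-(1 / 2))) k0Data13 ∧ FirstOrderExpansion (k0Model 0 (-(1 / 2))) k0Data13 ∧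
      ModelConsistentOn (k0Model 0 (-(1 / 2))) k0Data13.1 k0Data13.2.1 k0Data13.2.2.1 k0Data13.2.2.2 :=
  ⟨firstOrderExpansion_of_direct _ bah_k0Direct hexp_k0Direct, vbell_firstOrder_of_direct _ bah_k0Direct hexp_k0Direct,
    expansion_of_slots bah_k0Direct hexp_k0Direct, firstOrderExpansion_of_slots bah_k0Direct hexp_k0Direct,
    modelConsistentOn_of_slots bah_k0Direct hexp_k0Direct⟩

/-- **Consumer applied (`HExp.mono`)**: the member's expansion slot weakened to threshold `2` and remainder `2`.
[cite: Zhang2022LandauSiegel, §2 (2.32); §9 (9.1)] -/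
theorem hexp_k0Direct_mono : HExp (k0Model 0 (-(1 / 2))) (modelExactForm k0Data13) k0Data13 2 2 :=
  (hexp_modelExactForm (k0Model 0 (-(1 / 2))) k0Data13 1).mono (by norm_num) (by norm_num) (by norm_num)

/-- **A named two-sided member with NON-DEGENERATE slots**: direct piece = the `k₁ − k₃` model-exact form and data,
second piece (in the reflected slot) = the `k₂ + k₃` model-exact form and data, common box of record, `A₀ = K₁ = K₂ = 1`.
(A MODEL member: the reflected-piece CONTENT D-ELL-1c-II is not instantiated.) [cite: Zhang2022LandauSiegel, §2 (2.32); §9 (9.1); §12 (12.8)] -/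
def k0TwoSidedMember : TwoSidedDesign where
  e := ⟨0.504, 0.5, 0.498, 0.5⟩
  σ := ⟨0, 0⟩
  dataI := k0Data13
  dataII := k0Data23
  𝓜 := k0Model 0 (-(1 / 2))
  QI := modelExactForm k0Data13
  QII := modelExactForm k0Data23
  A₀ := 1
  K₁ := 1
  K₂ := 1

/-- The two-sided member is in the class `KTwoSided`. [cite: Zhang2022LandauSiegel, §2 (2.21); §14 (14.2)] -/
theorem kTwoSided_k0TwoSidedMember : KTwoSided k0TwoSidedMember := ellAdmissible_one_printed

/-- Slot hexp of the direct piece. [cite: Zhang2022LandauSiegel, §2 (2.32)] -/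
theorem hexp_k0TwoSided :
    HExp k0TwoSidedMember.𝓜 k0TwoSidedMember.QI k0TwoSidedMember.dataI k0TwoSidedMember.A₀ k0TwoSidedMember.K₁ :=
  hexp_modelExactForm _ _ _

/-- Slot hexp_II of the second piece. [cite: Zhang2022LandauSiegel, §9 (9.1); §12 (12.8)] -/
theorem hexpII_k0TwoSided :
    HExpII k0TwoSidedMember.𝓜 k0TwoSidedMember.QII k0TwoSidedMember.dataII k0TwoSidedMember.A₀ k0TwoSidedMember.K₂ :=
  hexp_modelExactForm _ _ _

/-- Slot hQ on the TOTAL form `QI + QII` (each summand `≥ 0` on the box for `A ≥ 1`).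
[cite: Zhang2022LandauSiegel, §2 Lemma 2.3, (2.15), (2.32); §9 (9.1)] -/
theorem bah_k0TwoSided_total :
    BAH k0TwoSidedMember.𝓜 (fun p A => k0TwoSidedMember.QI p A + k0TwoSidedMember.QII p A) k0TwoSidedMember.A₀ :=
  fun p hp A hA => add_nonneg (bah_modelExactForm modelConsistentOn_k0Data13 p hp A hA)
    (bah_modelExactForm modelConsistentOn_k0Data23 p hp A hA)

/-- **Consumers applied (two-sided member)**: `hexp_add`, `hexpII_of_pieces`, `hexp_total_of_twoSided`,
`firstOrderExpansion_of_twoSided`, `vbell_firstOrder_of_twoSided` at the member's three slots.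
[cite: Zhang2022LandauSiegel, §2 Lemma 2.3, (2.32); §9 (9.1)] -/
theorem k0TwoSided_witness :
    HExp (k0Model 0 (-(1 / 2))) (fun p A => modelExactForm k0Data13 p A + modelExactForm k0Data23 p A)
        (addData k0Data13 k0Data23) 1 (1 + 1) ∧
      HExpII (k0Model 0 (-(1 / 2))) (fun p A => modelExactForm k0Data13 p A + modelExactForm k0Data23 p A)
        (addData k0Data13 k0Data23) 1 (1 + 1) ∧
      HExp k0TwoSidedMember.𝓜 (fun p A => k0TwoSidedMember.QI p A + k0TwoSidedMember.QII p A)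
        (addData k0TwoSidedMember.dataI k0TwoSidedMember.dataII) k0TwoSidedMember.A₀
        (k0TwoSidedMember.K₁ + k0TwoSidedMember.K₂) ∧
      FirstOrderExpansion k0TwoSidedMember.𝓜 (addData k0TwoSidedMember.dataI k0TwoSidedMember.dataII) ∧
      ModelConsistentOn k0TwoSidedMember.𝓜 (addData k0TwoSidedMember.dataI k0TwoSidedMember.dataII).1
        (addData k0TwoSidedMember.dataI k0TwoSidedMember.dataII).2.1
        (addData k0TwoSidedMember.dataI k0TwoSidedMember.dataII).2.2.1
        (addData k0TwoSidedMember.dataI k0TwoSidedMember.dataII).2.2.2 :=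
  ⟨hexp_add hexp_k0TwoSided hexpII_k0TwoSided, hexpII_of_pieces hexp_k0TwoSided hexpII_k0TwoSided,
    hexp_total_of_twoSided _ hexp_k0TwoSided hexpII_k0TwoSided,
    firstOrderExpansion_of_twoSided _ bah_k0TwoSided_total hexp_k0TwoSided hexpII_k0TwoSided,
    vbell_firstOrder_of_twoSided _ bah_k0TwoSided_total hexp_k0TwoSided hexpII_k0TwoSided⟩

/-! ### §2 — `Repair.HasMainConstant` for the UNIT table, derived from the closed units lemma -/

/-- **The unit table** `F ≡ 1` over the sampled pairs (the value table of the Dirichlet polynomial `1`).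
[cite: Zhang2022LandauSiegel, §2 (2.16)] -/
def unitTable : (D : ℕ) → [NeZero D] → DirichletCharacter ℂ D → Chr D → ℂ → ℂ := fun _ _ _ _ _ => 1

/-- **The scale `𝓛⁹`** (`𝓛 = log D`; the trivial-bound scale of the discrete weight, `discWeight ∼ (8/π)𝓛⁹𝔓`).
[cite: Zhang2022LandauSiegel, §2 (2.16); §7 Prop 7.1] -/
def ellNine : Scale := fun D _ _ => ell D ^ 9

/-- `M ≤ 𝓛` for all large `D`. [cite: Zhang2022LandauSiegel, §2 p. 4] -/
private theorem forAllLarge_le_ell_aux (M : ℝ) : ForAllLarge fun D _ _ => M ≤ ell D := by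
  refine ForAllLarge.of_le ⌈Real.exp M⌉₊ fun D _ χ hD _ _ => ?_
  have hD' : Real.exp M ≤ (D : ℝ) := (Nat.le_ceil _).trans (by exact_mod_cast hD)
  calc M = Real.log (Real.exp M) := (Real.log_exp M).symm
    _ ≤ Real.log D := Real.log_le_log (Real.exp_pos M) hD'

/-- The scale `𝓛⁹` is eventually positive (under (A), trivially: `𝓛 ≥ 1` for large `D`).
[cite: Zhang2022LandauSiegel, §2 (2.31)] -/
theorem scaleEventuallyPos_ellNine : ScaleEventuallyPos ellNine :=
  (forAllLarge_le_ell_aux 1).mono fun D _ χ _ _ h _ => by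
    change 0 < ell D ^ 9
    exact pow_pos (one_pos.trans_le h) 9

/-- With non-negative weights (Lemma 2.3 / Prop. 2.2 (i)), the discrete mean of the unit table IS the discrete weight
`Σ |Re 𝔠*·Re ω|`. [cite: Zhang2022LandauSiegel, §2 Lemma 2.3, (2.15)–(2.16)] -/
theorem discMean_unitTable_eq_discWeight {c' : ℝ} {D : ℕ} [NeZero D] {χ : DirichletCharacter ℂ D}
    (hw : ∀ i ∈ idx χ, 0 ≤ (cstar c' D i.1 i.2).re * (omegaW D i.2).re) :
    KnifeEdge.discMean c' χ (unitTable D χ) = Repair.discWeight c' χ := by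
  unfold KnifeEdge.discMean Repair.discWeight unitTable
  refine Finset.sum_congr rfl fun i hi => ?_
  rw [abs_of_nonneg (hw i hi), norm_one, one_pow, mul_one]

/-- **`HasMainConstant` INHABITED by a derived row**: for every sufficiently large `c′`, the unit table has main
constant `8/π` at the scale `𝓛⁹` — `|discMean(1) − (8/π)𝓛⁹𝔓| ≤ ε𝓛⁹𝔓` for all large `D` under (A) — from the fully
closed units lemma `KnifeEdge.discWeight_trivialScale_closed'` (error `(C𝓛² + ε/2)𝔓 ≤ ε𝓛⁹𝔓` once
`𝓛 ≥ max 1 (2|C|/ε + 1)`) and `discMean(1) = discWeight` (`weights_nonneg_of`, Lemma 2.3 by `Skeleton.partOne_eventually`,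
Prop. 2.2 (i) by `prop22i_holds`). [cite: Zhang2022LandauSiegel, §2 (2.16), Lemma 2.3; §7 Prop 7.1; §8 Lemma 8.1] -/
theorem hasMainConstant_unitTable :
    ∃ c₀ : ℝ, 0 ≤ c₀ ∧ ∀ c' : ℝ, c₀ ≤ c' → HasMainConstant c' ellNine unitTable (8 / π) := by
  obtain ⟨c₁, h1, H⟩ := discWeight_trivialScale_closed'
  obtain ⟨c₂, _, H2⟩ := Skeleton.partOne_eventually
  obtain ⟨D₃, hP⟩ := frakP_eventually_pos
  refine ⟨max c₁ c₂, h1.trans (le_max_left _ _), fun c' hc' ε hε => ?_⟩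
  obtain ⟨C, hC⟩ := H c' ((le_max_left _ _).trans hc') (ε / 2) (half_pos hε)
  have h23 : Lemma23 c' := (H2 c' ((le_max_right _ _).trans hc')).2.1
  obtain ⟨D₀, hD₀⟩ := ((hC.and h23).and prop22i_holds).and (forAllLarge_le_ell_aux (max 1 (2 * |C| / ε + 1)))
  refine ⟨max (max D₀ D₃) 3, fun D _ χ hD hq hp hA => ?_⟩
  have hD0 : D₀ ≤ D := le_trans (le_trans (le_max_left _ _) (le_max_left _ _)) hD
  have hD3' : D₃ ≤ D := le_trans (le_trans (le_max_right _ _) (le_max_left _ _)) hD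
  have hD3 : 3 ≤ D := le_trans (le_max_right _ _) hD
  obtain ⟨⟨⟨hCw, h23'⟩, h22'⟩, hM⟩ := hD₀ D χ hD0 hq hp
  have hw := weights_nonneg_of hD3 h23' h22'
  have hPpos : 0 < frakP D := hP D hD3'
  have hℓ1 : 1 ≤ ell D := (le_max_left _ _).trans hM
  have hℓC : 2 * |C| / ε + 1 ≤ ell D := (le_max_right _ _).trans hM
  have key : C * ell D ^ 2 + ε / 2 ≤ ε * ell D ^ 9 := by
    have h9 : ell D ^ 3 ≤ ell D ^ 9 := pow_le_pow_right₀ hℓ1 (by norm_num)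
    have hℓ2 : 1 ≤ ell D ^ 2 := one_le_pow₀ hℓ1
    have hεℓ : ε * (2 * |C| / ε + 1) = 2 * |C| + ε := by field_simp
    have s1 : ε * ell D ^ 3 ≤ ε * ell D ^ 9 := mul_le_mul_of_nonneg_left h9 hε.le
    have s2 : (2 * |C| + ε) * ell D ^ 2 ≤ ε * ell D ^ 3 := by
      rw [← hεℓ, show ell D ^ 3 = ell D * ell D ^ 2 by ring, ← mul_assoc]
      exact mul_le_mul_of_nonneg_right (mul_le_mul_of_nonneg_left hℓC hε.le) (sq_nonneg _)
    have s3 : C * ell D ^ 2 + ε / 2 ≤ (2 * |C| + ε) * ell D ^ 2 := by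
      nlinarith [le_abs_self C, abs_nonneg C, hℓ2, hε]
    linarith
  rw [discMean_unitTable_eq_discWeight hw]
  change |Repair.discWeight c' χ - 8 / π * ell D ^ 9 * frakP D| ≤ ε * ell D ^ 9 * frakP D
  calc |Repair.discWeight c' χ - 8 / π * ell D ^ 9 * frakP D| ≤ (C * ell D ^ 2 + ε / 2) * frakP D := hCw hA
    _ ≤ ε * ell D ^ 9 * frakP D := by
      rw [mul_assoc ε]
      have := mul_le_mul_of_nonneg_right key hPpos.le
      simpa [mul_assoc] using this

end Literature.NumberTheory.LFunctions.Zhang2022.Repair.SatWitness
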